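import Summits.BirchSwinnertonDyer.BirchSwinnertonDyer.Theorems.SignedBaseChangeAnticyclotomicEisensteinDivisibilityTwistDeformationLOC1
import Summits.BirchSwinnertonDyer.BirchSwinnertonDyer.Theorems.SignedBaseChangeAnticyclotomicEisensteinDivisibilityFiniteExponentOfLOC1
import HarnessLib

/-!
# `X_Gr(E/K̃_∞)` has no non-zero pseudo-null `Λ₂`-submodule — and `X_Gr₂[T₁]` has finite exponent at
# `(T₁) ∉ Supp` — GRANTED ONLY the six PUBLISHED facts of Greenberg 2016 / 2006 (crux
# `AnticyclotomicEisensteinDivisibility`, stmt-BirchSwinnertonDyer-20727, line `bdpline`: both kernel bricks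
# (R1a), (R1b) of the Greenberg road for `stub_finiteExponentSS` DISCHARGED; helper for stmt-BirchSwinnertonDyer-20727)

Cell `bsd-ssimc` (hosting route `SignedBaseChange`), width seat `bsd-line-sbc-p1-w2` gen 4; fourth file of
the lane. The Greenberg-2016 road for `stub_finiteExponentSS` (bsd-line-sbc-p1-w2 gen 3: end layer p624977,
squeeze p625450, bridge p625961, model p626463, algebra p626784, assembly p627029, bricks form p627602;
lead's telescope p628494) left two KERNEL bricks: (R1a) `E[p^∞]` cofree with a Tate-dual basis — PROVED by
bsd-line-sbc-p1-w3 (`SignedBaseChangeAcDivCofree`, p628727; plugged in by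
`SignedBaseChangeAcDivNoPseudoNullLOC1` / `…FiniteExponentTelescopeLOC1`, p629689) — and (R1b) LOC_v⁽¹⁾ /
`corank H⁰ = 0` for the twist deformation — PROVED by this seat (`SignedBaseChangeAcDivTwistLOC1`,
p631353: determinant form of [Greenberg2010] Lemma 5.2.2, any `ρ₀`). This file plugs (R1b) in:

* `xGr₂_hasNoPseudoNullSubmodule_of_facts` — for `W/K` elliptic, `K` imaginary quadratic, `2 < p = v v̄`
  split, a generator pair: `X_Gr₂ = X_Gr(E/K̃_∞)` has NO non-zero pseudo-null `Λ₂`-submodule, granted the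
  six published facts BY NAME (`Greenberg2016.prop411_…`, `prop422_…`, `Greenberg2006.sec5A_…`,
  `prop41_…`, `prop42_…`, `prop32_…`) and the `Λ₂`-torsion of `X_Gr₂` — nothing else.
* `xGr₂_torsionBy_X_finiteExponent_of_facts` — hence `X_Gr₂[T₁]` has finite exponent (indeed is `0`) at
  `length_{(T₁)} X_Gr₂ = 0`.
* `finiteExponent_of_facts` — the conclusion of the line's `stub_finiteExponentSS` granted the six facts
  ONLY (torsion derived from the length hypothesis inside the lead's telescope).

Theorems only; no definition, no named fact, no `sorry`. HONEST FRAMING: CONDITIONAL on the six PUBLISHED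
named facts (Greenberg 2016 Props. 4.1.1 / 4.2.2; Greenberg 2006 Props. 3.2 / 4.1 / 4.2 / §5 A), taken as
hypotheses; closes nothing by itself (`--supports stmt-BirchSwinnertonDyer-20727`); no summit statement /
BSD is proved by this file. References: [Greenberg2016Selmer] R. Greenberg, *On the structure of Selmer
groups* (2016), Prop. 4.1.1 (c) p. 15, Prop. 4.2.2 p. 20, §4.3 pp. 20–21; [Greenberg2006] Doc. Math.
Extra Vol. Coates (2006), Thm. 3 p. 342, Props. 3.2 / 4.1 / 4.2, §5 A; [Greenberg2010] Lemma 5.2.2;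
[BurungaleCastellaSkinner2025] §2.1 p. 6 (`X_Gr`).
-/

-- `Summit.BirchSwinnertonDyer.BirchSwinnertonDyer.…`: summit and sub-problem share a name (D-0017 layout).
set_option linter.dupNamespace false
set_option autoImplicit false

noncomputable section

open scoped Classical
open NumberField IsDedekindDomain Field
open Literature.NumberTheory.EllipticCurves Literature.NumberTheory.GaloisRepresentations
  Literature.NumberTheory.EllipticCurves.Rubin1991
  Literature.NumberTheory.IwasawaTheory Literature.NumberTheory.IwasawaTheory.Greenberg2006
  Literature.NumberTheory.IwasawaTheory.Greenberg2016
  Summit.BirchSwinnertonDyer.BirchSwinnertonDyer.Theorems.SignedBaseChangeAcDivTwistLOC1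
  Summit.BirchSwinnertonDyer.BirchSwinnertonDyer.Theorems.SignedBaseChangeAcDivNoPseudoNullLOC1
  Summit.BirchSwinnertonDyer.BirchSwinnertonDyer.Theorems.SignedBaseChangeAcDivFiniteExponentTelescope
  Summit.BirchSwinnertonDyer.BirchSwinnertonDyer.Theorems.SignedBaseChangeAcDivFiniteExponentTelescopeLOC1

namespace Summit.BirchSwinnertonDyer.BirchSwinnertonDyer.Theorems.SignedBaseChangeAcDivNoPseudoNullOfFacts

/-! ## §1 No pseudo-null submodules and the finite exponent of `X_Gr₂[T₁]`, from the six facts and torsion -/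

section Torsion

variable {K : Type} [Field K] [NumberField K] {p : ℕ} [Fact p.Prime] (W : WeierstrassCurve K)
  [W.IsElliptic] (κ₁ κ₂ : ZpExtension K p) (vbar : HeightOneSpectrum (𝓞 K)) (γ₁ γ₂ : absoluteGaloisGroup K)
  [hγ : Fact (ZpExtension.IsTopGeneratorPair κ₁ κ₂ γ₁ γ₂)]

/-- **`X_Gr(E/K̃_∞)` has no non-zero pseudo-null `Λ₂`-submodule, GRANTED ONLY the six published facts and the
`Λ₂`-torsion of `X_Gr₂`** (`W/K` elliptic, `K` imaginary quadratic, `2 < p` split as `v v̄`, a generator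
pair): bsd-line-sbc-p1-w3's `xGr₂_hasNoPseudoNullSubmodule_of_loc1` with (R1b) supplied by
`loc1_and_hasCorank_H0_zero_curve` (every `S ⊇ {w ∣ p}`, every `ρ₀`).
[cite: Greenberg2016Selmer, Prop. 4.1.1 (c) (§4.1 p. 15), §4.3 pp. 20–21] [cite: Greenberg2006, Thm. 3 p. 342]
[cite: Greenberg2010, Lemma 5.2.2 (PDF p. 28 L20–21)] -/
theorem xGr₂_hasNoPseudoNullSubmodule_of_facts
    (h411 : prop411_selmer_isAlmostDivisible) (h422 : prop422_localCohomology_isAlmostDivisible)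
    (h5A : sec5A_localH2_subsingleton_of_LOC1) (h41 : prop41_globalEulerPoincareCorank)
    (h42 : prop42_localEulerPoincareCorank) (h32 : prop32_cohomology_isCofinitelyGenerated)
    (hp : 2 < p) (hK : IsImaginaryQuadratic K)
    {v : HeightOneSpectrum (𝓞 K)} (hv : ((p : ℕ) : 𝓞 K) ∈ v.asIdeal)
    (hvbar : ((p : ℕ) : 𝓞 K) ∈ vbar.asIdeal) (hne : vbar ≠ v)
    (htors : Module.IsTorsion (IwasawaAlgebra₂ p) (W.XGr₂ p κ₁ κ₂ vbar γ₁ γ₂)) :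
    HasNoPseudoNullSubmodule (IwasawaAlgebra₂ p) (W.XGr₂ p κ₁ κ₂ vbar γ₁ γ₂) :=
  xGr₂_hasNoPseudoNullSubmodule_of_loc1 W κ₁ κ₂ vbar γ₁ γ₂ h411 h422 h5A h41 h42 h32 hp hK hv hvbar hne htors
    fun S hS ρ₀ _ ↦ by
      obtain ⟨h1, h0, h00⟩ := loc1_and_hasCorank_H0_zero_curve W κ₁ κ₂ hK hγ.out S hS ρ₀
      exact ⟨fun w _ ↦ h1 w, fun w _ ↦ h0 w, h00⟩

/-- **`X_Gr₂[T₁]` has finite exponent (indeed is `0`) at `length_{(T₁)} X_Gr₂ = 0`, GRANTED ONLY the six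
published facts and the `Λ₂`-torsion of `X_Gr₂`.** [cite: Greenberg2016Selmer, Prop. 4.1.1 (c) (§4.1 p. 15)]
[cite: BurungaleCastellaSkinner2025, §2.1 p. 6] -/
theorem xGr₂_torsionBy_X_finiteExponent_of_facts
    (h411 : prop411_selmer_isAlmostDivisible) (h422 : prop422_localCohomology_isAlmostDivisible)
    (h5A : sec5A_localH2_subsingleton_of_LOC1) (h41 : prop41_globalEulerPoincareCorank)
    (h42 : prop42_localEulerPoincareCorank) (h32 : prop32_cohomology_isCofinitelyGenerated)
    (hp : 2 < p) (hK : IsImaginaryQuadratic K)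
    {v : HeightOneSpectrum (𝓞 K)} (hv : ((p : ℕ) : 𝓞 K) ∈ v.asIdeal)
    (hvbar : ((p : ℕ) : 𝓞 K) ∈ vbar.asIdeal) (hne : vbar ≠ v)
    (htors : Module.IsTorsion (IwasawaAlgebra₂ p) (W.XGr₂ p κ₁ κ₂ vbar γ₁ γ₂))
    (h0 : Literature.NumberTheory.EllipticCurves.Module.lengthAt (IwasawaAlgebra₂ p) (W.XGr₂ p κ₁ κ₂ vbar γ₁ γ₂)
      ⟨Ideal.span {(PowerSeries.X : IwasawaAlgebra₂ p)}, PowerSeries.span_X_isPrime⟩ = 0) :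
    ∃ m : ℕ, ∀ x : W.XGr₂ p κ₁ κ₂ vbar γ₁ γ₂, (PowerSeries.X : IwasawaAlgebra₂ p) • x = 0 →
      ((p : IwasawaAlgebra₂ p) ^ m) • x = 0 :=
  xGr₂_torsionBy_X_finiteExponent_of_loc1 W κ₁ κ₂ vbar γ₁ γ₂ h411 h422 h5A h41 h42 h32 hp hK hv hvbar hne htors
    (fun S hS ρ₀ _ ↦ by
      obtain ⟨h1, h0, h00⟩ := loc1_and_hasCorank_H0_zero_curve W κ₁ κ₂ hK hγ.out S hS ρ₀
      exact ⟨fun w _ ↦ h1 w, fun w _ ↦ h0 w, h00⟩) h0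

end Torsion

/-! ## §2 The conclusion of `stub_finiteExponentSS` from the six facts ONLY -/

section Facts

variable {K : Type} [Field K] [NumberField K] {p : ℕ} [Fact p.Prime] (W : WeierstrassCurve K) [W.IsElliptic]
  [TopologicalSpace (PowerSeries ℤ_[p])] [TopologicalSpace (PowerSeries (PowerSeries ℤ_[p]))]
  [IsTopologicalRing (PowerSeries (PowerSeries ℤ_[p]))]
  [IsTopologicalAddGroup (IndModule₂ ℤ_[p] p (PrimaryTorsion W.geomPoints p))]
  [ContinuousSMul (PowerSeries (PowerSeries ℤ_[p])) (IndModule₂ ℤ_[p] p (PrimaryTorsion W.geomPoints p))]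
  (κ₁ κ₂ : ZpExtension K p) (vbar : HeightOneSpectrum (𝓞 K)) (γ₁ γ₂ : absoluteGaloisGroup K)
  [hγ : Fact (ZpExtension.IsTopGeneratorPair κ₁ κ₂ γ₁ γ₂)]

/-- **The finite exponent of `X_Gr₂[T₁]` at `(T₁) ∉ Supp X_Gr₂` — the conclusion of the registered
`stub_finiteExponentSS` of line `bdpline` for an elliptic `W/K` (`K` imaginary quadratic, `2 < p = v v̄`, a
generator pair) — GRANTED ONLY the six PUBLISHED facts BY NAME**: bsd-line-sbc-p1-w3's `finiteExponent_of_loc1`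
(the lead's telescope with (R1a) discharged; torsion from the length hypothesis) with (R1b) supplied by
`stub_twistDeformationLOC1SS` / `loc1_and_hasCorank_H0_zero_curve`. Every kernel brick of the Greenberg road is
now a theorem; what remains named is print (Greenberg 2016 Props. 4.1.1 / 4.2.2, Greenberg 2006 Props. 3.2 /
4.1 / 4.2 / §5 A). [cite: Greenberg2016Selmer, Prop. 4.1.1 (c) (§4.1 p. 15), Prop. 4.2.2 (§4.2 p. 20)]
[cite: Greenberg2006, Props. 3.2, 4.1, 4.2, §5 A; Thm. 3 p. 342] [cite: Greenberg2010, Lemma 5.2.2 (PDF p. 28 L20–21)] -/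
theorem finiteExponent_of_facts
    (h411 : prop411_selmer_isAlmostDivisible) (h422 : prop422_localCohomology_isAlmostDivisible)
    (h5A : sec5A_localH2_subsingleton_of_LOC1) (h41 : prop41_globalEulerPoincareCorank)
    (h42 : prop42_localEulerPoincareCorank) (h32 : prop32_cohomology_isCofinitelyGenerated)
    (hp : 2 < p) (hK : IsImaginaryQuadratic K)
    {v : HeightOneSpectrum (𝓞 K)} (hv : ((p : ℕ) : 𝓞 K) ∈ v.asIdeal)
    (hvbar : ((p : ℕ) : 𝓞 K) ∈ vbar.asIdeal) (hne : vbar ≠ v)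
    (h0 : Literature.NumberTheory.EllipticCurves.Module.lengthAt (IwasawaAlgebra₂ p) (W.XGr₂ p κ₁ κ₂ vbar γ₁ γ₂)
      ⟨Ideal.span {(PowerSeries.X : IwasawaAlgebra₂ p)}, PowerSeries.span_X_isPrime⟩ = 0) :
    ∃ m : ℕ, ∀ x : W.XGr₂ p κ₁ κ₂ vbar γ₁ γ₂,
      (PowerSeries.X : IwasawaAlgebra₂ p) • x = 0 → ((p : IwasawaAlgebra₂ p) ^ m) • x = 0 :=
  finiteExponent_of_loc1 W κ₁ κ₂ vbar γ₁ γ₂ h411 h422 h5A h41 h42 h32 hp hK hv hvbar hne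
    (fun ρ₀ _ ↦ by
      obtain ⟨h1, h0', h00⟩ :=
        loc1_and_hasCorank_H0_zero_curve W κ₁ κ₂ hK hγ.out _ (mem_badOrP_of_natCast_mem W p) ρ₀
      exact ⟨fun w _ ↦ h1 w, fun w _ ↦ h0' w, h00⟩) h0

end Facts

end Summit.BirchSwinnertonDyer.BirchSwinnertonDyer.Theorems.SignedBaseChangeAcDivNoPseudoNullOfFacts

end
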